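import Mathlib
import Summits.KontsevichZagierPeriods.KontsevichZagierPeriods.Theorems.SoloInformedLegendreThirdKind
import Summits.KontsevichZagierPeriods.KontsevichZagierPeriods.Theorems.SoloInformedLiftMoves
import Literature.NumberTheory.Transcendental.EllIterRep
import Literature.NumberTheory.Transcendental.KZDominatedFamilyRelations
import Literature.NumberTheory.Transcendental.KZLogCalculusProofs
import HarnessLib
import HarnessLib.Audit

/-!
# Kummer family I: bisecting the complementary quarter-period by ONE involution move (s39)

LEMMA XXVIII.2 (first kind) of the residency paper (§6quattuordecies).  For a real algebraic
modulus `0 < k < 1` put `k'² = 1 − k²`, `f(t) = ((1−t²)(1−k'²t²))^{-1/2}`, and let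
`s_k = 1/√(1+k)` be the BISECTION POINT (`sin²φ_k = 1/(1+k) = sn²(K'/2, k')`).  Then in `P`
  `2·⟦[(0,s_k), f]⟧ = ⟦[(0,1), f]⟧`,  i.e.  `2⟦F̃_k⟧ = ⟦K'⟧`  (`F(φ_k, k') = K(k')/2`),
by ONE MOVE of rule (2): the semialgebraic involution `τ(t) = √(1−t²)/√(1−k'²t²)` of `(0,1)`
(`v ↦ K' − v` read through `t = sn(v,k')`) exchanges `(0,s_k)` and `(s_k,1)`, fixes `s_k`, and
`1 − τ² = k²t²/(1−k'²t²)`, `1 − k'²τ² = k²/(1−k'²t²)`, `τ' = −k²t·f(t)/(1−k'²t²)`, so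
`f(τ(t))·|τ'(t)| = f(t)`; domain additivity at the null point `s_k` finishes.  This is the torsion
input of COROLLARY XXVIII.1 (fibre `n = k` of the third-kind reciprocity law = THEOREM XXIV).

References: A. M. Legendre, Traité des fonctions elliptiques I (1825), ch. VI; M. Abramowitz –
I. Stegun, Handbook (1964), 17.4.17–18, 17.7.14; D. F. Lawden, Elliptic Functions and Applications
(1989), § 3.8; M. Kontsevich – D. Zagier, Periods (2001), § 1.2; this work.
-/

noncomputable section

open MeasureTheory Set Filter
open scoped Classical

open Literature.NumberTheory.Transcendental Literature.NumberTheory.Transcendental.KZ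
open Literature.ModelTheory.ExponentialFields

namespace Summit.KontsevichZagierPeriods.KontsevichZagierPeriods.Theorems

/-! ### The bisection point (slabs with algebraic endpoints are semialgebraic: `EllIterRep`) -/

/-- Bisection point `s_k = 1/√(1+k)` (`0 < k < 1`): `0 < s_k < 1`, `s_k² = 1/(1+k)`. [folklore] -/
theorem soloInformed_bisectionPoint {k : ℝ} (hk : k ∈ Ioo (0:ℝ) 1) :
    0 < (√(1 + k))⁻¹ ∧ (√(1 + k))⁻¹ < 1 ∧ ((√(1 + k))⁻¹) ^ 2 = (1 + k)⁻¹ := by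
  have h1 : 0 < 1 + k := by linarith [hk.1]
  have hr : 0 < √(1 + k) := Real.sqrt_pos.2 h1
  refine ⟨inv_pos.2 hr, inv_lt_one_of_one_lt₀ ?_, by rw [inv_pow, Real.sq_sqrt h1.le]⟩
  exact (Real.lt_sqrt zero_le_one).2 (by rw [one_pow]; linarith [hk.1])

/-- The bisection point of an algebraic modulus is algebraic. [folklore] -/
theorem soloInformed_bisectionPoint_isAlgebraic {k : ℝ} (hk : k ∈ Ioo (0:ℝ) 1)
    (hka : IsAlgebraic ℚ k) : IsAlgebraic ℚ ((√(1 + k))⁻¹) := by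
  have h1 : 0 < 1 + k := by linarith [hk.1]
  have hra : IsAlgebraic ℚ (√(1 + k)) :=
    IsAlgebraic.of_pow two_pos (by rw [Real.sq_sqrt h1.le]; exact isAlgebraic_one.add hka)
  exact hra.inv

/-! ### The involution `τ(t) = √(1−t²)/√(1−k'²t²)` -/

/-- Under the involution: `1 − τ² = k²t²/(1−k'²t²)`, `1 − k'²τ² = k²/(1−k'²t²)`. [this work] -/
theorem soloInformed_bisection_involution_sq {k t : ℝ} (ht : t ∈ Ioo (0:ℝ) 1) :
    1 - (√(1 - t ^ 2) / √(1 - (1 - k ^ 2) * t ^ 2)) ^ 2 = (k * t) ^ 2 / (1 - (1 - k ^ 2) * t ^ 2) ∧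
    1 - (1 - k ^ 2) * (√(1 - t ^ 2) / √(1 - (1 - k ^ 2) * t ^ 2)) ^ 2 =
      k ^ 2 / (1 - (1 - k ^ 2) * t ^ 2) := by
  have hu0 : 0 < 1 - t ^ 2 := by nlinarith [ht.1, ht.2]
  have hv0 : 0 < 1 - (1 - k ^ 2) * t ^ 2 := soloInformed_legendre_radicand_pos' ht (sq_nonneg k)
  have hv : 1 - (1 - k ^ 2) * t ^ 2 ≠ 0 := hv0.ne'
  rw [div_pow, Real.sq_sqrt hu0.le, Real.sq_sqrt hv0.le]
  constructor
  · rw [eq_div_iff hv, sub_mul, div_mul_cancel₀ _ hv]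
    ring
  · rw [eq_div_iff hv, sub_mul, mul_assoc, div_mul_cancel₀ _ hv]
    ring

/-- The transformed integrand: `f(τ(t)) = (k t/√(1−k'²t²))⁻¹ · (k/√(1−k'²t²))⁻¹`. [this work] -/
theorem soloInformed_bisection_involution_integrand {k t : ℝ} (hk : k ∈ Ioo (0:ℝ) 1)
    (ht : t ∈ Ioo (0:ℝ) 1) :
    (√(1 - (√(1 - t ^ 2) / √(1 - (1 - k ^ 2) * t ^ 2)) ^ 2))⁻¹ *
        (√(1 - (1 - k ^ 2) * (√(1 - t ^ 2) / √(1 - (1 - k ^ 2) * t ^ 2)) ^ 2))⁻¹ =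
      (k * t / √(1 - (1 - k ^ 2) * t ^ 2))⁻¹ * (k / √(1 - (1 - k ^ 2) * t ^ 2))⁻¹ := by
  have hv0 : 0 < 1 - (1 - k ^ 2) * t ^ 2 := soloInformed_legendre_radicand_pos' ht (sq_nonneg k)
  obtain ⟨h1, h2⟩ := soloInformed_bisection_involution_sq (k := k) ht
  rw [h1, h2, Real.sqrt_div' _ hv0.le, Real.sqrt_div' _ hv0.le,
    Real.sqrt_sq (mul_pos hk.1 ht.1).le, Real.sqrt_sq hk.1.le]

/-- The derivative of the involution: `τ'(t) = −k²t·f(t)/(1−k'²t²)` on `(0,1)`. [this work] -/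
theorem soloInformed_bisection_involution_hasDerivAt {k t : ℝ} (ht : t ∈ Ioo (0:ℝ) 1) :
    HasDerivAt (fun y : ℝ => √(1 - y ^ 2) / √(1 - (1 - k ^ 2) * y ^ 2))
      (-(k ^ 2 * t) * ((√(1 - t ^ 2))⁻¹ * (√(1 - (1 - k ^ 2) * t ^ 2))⁻¹) /
        (1 - (1 - k ^ 2) * t ^ 2)) t := by
  have hu0 : 0 < 1 - t ^ 2 := by nlinarith [ht.1, ht.2]
  have hv0 : 0 < 1 - (1 - k ^ 2) * t ^ 2 := soloInformed_legendre_radicand_pos' ht (sq_nonneg k)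
  have hU : √(1 - t ^ 2) ≠ 0 := (Real.sqrt_pos.2 hu0).ne'
  have hV : √(1 - (1 - k ^ 2) * t ^ 2) ≠ 0 := (Real.sqrt_pos.2 hv0).ne'
  have hu : HasDerivAt (fun y : ℝ => √(1 - y ^ 2)) ((0 - 2 * t) / (2 * √(1 - t ^ 2))) t :=
    ((hasDerivAt_const t (1:ℝ)).sub (soloInformed_hasDerivAt_sq t)).sqrt hu0.ne'
  have hv : HasDerivAt (fun y : ℝ => √(1 - (1 - k ^ 2) * y ^ 2))
      ((0 - (1 - k ^ 2) * (2 * t)) / (2 * √(1 - (1 - k ^ 2) * t ^ 2))) t :=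
    ((hasDerivAt_const t (1:ℝ)).sub ((soloInformed_hasDerivAt_sq t).const_mul (1 - k ^ 2))).sqrt
      hv0.ne'
  refine (hu.div hv hV).congr_deriv ?_
  have e1 : (0 - 2 * t) / (2 * √(1 - t ^ 2)) * √(1 - (1 - k ^ 2) * t ^ 2) =
      -(t * √(1 - (1 - k ^ 2) * t ^ 2) ^ 2) *
        ((√(1 - t ^ 2))⁻¹ * (√(1 - (1 - k ^ 2) * t ^ 2))⁻¹) := by
    field_simp
    ring
  have e2 : √(1 - t ^ 2) * ((0 - (1 - k ^ 2) * (2 * t)) / (2 * √(1 - (1 - k ^ 2) * t ^ 2))) =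
      -((1 - k ^ 2) * t * √(1 - t ^ 2) ^ 2) *
        ((√(1 - t ^ 2))⁻¹ * (√(1 - (1 - k ^ 2) * t ^ 2))⁻¹) := by
    field_simp
    ring
  rw [e1, e2, Real.sq_sqrt hu0.le, Real.sq_sqrt hv0.le]
  ring

/-- `f(t) = f(τ(t))·|τ'(t)|` on `(0,1)`: the integrand is invariant under the move. [this work] -/
theorem soloInformed_bisection_jacobian {k t : ℝ} (hk : k ∈ Ioo (0:ℝ) 1) (ht : t ∈ Ioo (0:ℝ) 1) :
    (√(1 - t ^ 2))⁻¹ * (√(1 - (1 - k ^ 2) * t ^ 2))⁻¹ =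
      (√(1 - (√(1 - t ^ 2) / √(1 - (1 - k ^ 2) * t ^ 2)) ^ 2))⁻¹ *
          (√(1 - (1 - k ^ 2) * (√(1 - t ^ 2) / √(1 - (1 - k ^ 2) * t ^ 2)) ^ 2))⁻¹ *
        |-(k ^ 2 * t) * ((√(1 - t ^ 2))⁻¹ * (√(1 - (1 - k ^ 2) * t ^ 2))⁻¹) /
          (1 - (1 - k ^ 2) * t ^ 2)| := by
  have hu0 : 0 < 1 - t ^ 2 := by nlinarith [ht.1, ht.2]
  have hv0 : 0 < 1 - (1 - k ^ 2) * t ^ 2 := soloInformed_legendre_radicand_pos' ht (sq_nonneg k)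
  rw [soloInformed_bisection_involution_integrand hk ht]
  set U : ℝ := √(1 - t ^ 2) with hU
  set V : ℝ := √(1 - (1 - k ^ 2) * t ^ 2) with hV
  have hU0 : 0 < U := Real.sqrt_pos.2 hu0
  have hV0 : 0 < V := Real.sqrt_pos.2 hv0
  have hUV : 0 < U⁻¹ * V⁻¹ := mul_pos (inv_pos.2 hU0) (inv_pos.2 hV0)
  have hneg : -(k ^ 2 * t) * (U⁻¹ * V⁻¹) / (1 - (1 - k ^ 2) * t ^ 2) < 0 :=
    div_neg_of_neg_of_pos (mul_neg_of_neg_of_pos (neg_lt_zero.2 (mul_pos (pow_pos hk.1 2) ht.1))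
      hUV) hv0
  have hV2 : V ^ 2 = 1 - (1 - k ^ 2) * t ^ 2 := Real.sq_sqrt hv0.le
  have := hk.1.ne'; have := ht.1.ne'; have := hU0.ne'; have := hV0.ne'
  rw [abs_of_neg hneg, ← hV2]
  field_simp

/-- The involution is injective on `(0,1)`. [this work] -/
theorem soloInformed_bisection_involution_injOn {k : ℝ} (hk : k ∈ Ioo (0:ℝ) 1) :
    InjOn (fun t : ℝ => √(1 - t ^ 2) / √(1 - (1 - k ^ 2) * t ^ 2)) (Ioo (0:ℝ) 1) := by
  intro a ha b hb h
  have hua : 0 < 1 - a ^ 2 := by nlinarith [ha.1, ha.2]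
  have hub : 0 < 1 - b ^ 2 := by nlinarith [hb.1, hb.2]
  have hva : 0 < 1 - (1 - k ^ 2) * a ^ 2 := soloInformed_legendre_radicand_pos' ha (sq_nonneg k)
  have hvb : 0 < 1 - (1 - k ^ 2) * b ^ 2 := soloInformed_legendre_radicand_pos' hb (sq_nonneg k)
  have h' : √(1 - a ^ 2) / √(1 - (1 - k ^ 2) * a ^ 2) =
      √(1 - b ^ 2) / √(1 - (1 - k ^ 2) * b ^ 2) := h
  rw [div_eq_div_iff (Real.sqrt_pos.2 hva).ne' (Real.sqrt_pos.2 hvb).ne'] at h'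
  have h2 := congrArg (fun z : ℝ => z ^ 2) h'
  simp only [mul_pow, Real.sq_sqrt hua.le, Real.sq_sqrt hub.le, Real.sq_sqrt hva.le,
    Real.sq_sqrt hvb.le] at h2
  have e : k ^ 2 * (b ^ 2 - a ^ 2) = 0 := by linear_combination h2
  have hk2 : k ^ 2 ≠ 0 := pow_ne_zero 2 hk.1.ne'
  have hab : a ^ 2 = b ^ 2 := by
    rcases mul_eq_zero.1 e with e | e
    · exact absurd e hk2
    · linarith
  exact (pow_left_inj₀ ha.1.le hb.1.le two_ne_zero).1 hab

/-- The involution maps `(0, s_k)` into `(s_k, 1)`. [this work] -/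
theorem soloInformed_bisection_involution_mem {k t : ℝ} (hk : k ∈ Ioo (0:ℝ) 1)
    (ht : t ∈ Ioo (0:ℝ) (√(1 + k))⁻¹) :
    √(1 - t ^ 2) / √(1 - (1 - k ^ 2) * t ^ 2) ∈ Ioo (√(1 + k))⁻¹ 1 := by
  obtain ⟨hs0, hs1, hs2⟩ := soloInformed_bisectionPoint hk
  have h1k : 0 < 1 + k := by linarith [hk.1]
  have ht1 : t ∈ Ioo (0:ℝ) 1 := ⟨ht.1, ht.2.trans hs1⟩
  have hu0 : 0 < 1 - t ^ 2 := by nlinarith [ht1.1, ht1.2]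
  have hv0 : 0 < 1 - (1 - k ^ 2) * t ^ 2 := soloInformed_legendre_radicand_pos' ht1 (sq_nonneg k)
  have hU0 : 0 < √(1 - t ^ 2) := Real.sqrt_pos.2 hu0
  have hV0 : 0 < √(1 - (1 - k ^ 2) * t ^ 2) := Real.sqrt_pos.2 hv0
  have ht2 : t ^ 2 * (1 + k) < 1 := by
    have h : t ^ 2 < ((√(1 + k))⁻¹) ^ 2 := by nlinarith [ht.1, ht.2, hs0]
    simpa [hs2, inv_mul_cancel₀ h1k.ne'] using mul_lt_mul_of_pos_right h h1k
  constructor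
  · rw [lt_div_iff₀ hV0]
    refine (pow_lt_pow_iff_left₀ (mul_pos hs0 hV0).le hU0.le two_ne_zero).1 ?_
    rw [mul_pow, hs2, Real.sq_sqrt hu0.le, Real.sq_sqrt hv0.le, inv_mul_lt_iff₀ h1k]
    nlinarith [mul_pos hk.1 (sub_pos.2 ht2)]
  · rw [div_lt_one hV0]
    exact Real.sqrt_lt_sqrt hu0.le (by nlinarith [mul_pos (pow_pos hk.1 2) (pow_pos ht.1 2)])

/-- The bisection point is FIXED by the involution: `τ(s_k) = s_k`. [this work] -/
theorem soloInformed_bisection_involution_fixed {k : ℝ} (hk : k ∈ Ioo (0:ℝ) 1) :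
    √(1 - ((√(1 + k))⁻¹) ^ 2) / √(1 - (1 - k ^ 2) * ((√(1 + k))⁻¹) ^ 2) = (√(1 + k))⁻¹ := by
  obtain ⟨hs0, hs1, hs2⟩ := soloInformed_bisectionPoint hk
  have h1k : (1:ℝ) + k ≠ 0 := by linarith [hk.1]
  have hv0 : 0 < 1 - (1 - k ^ 2) * ((√(1 + k))⁻¹) ^ 2 := by
    rw [hs2, show (1 - k ^ 2) * (1 + k)⁻¹ = 1 - k by field_simp; ring]
    linarith [hk.1]
  have hV0 := Real.sqrt_pos.2 hv0
  have hid : 1 - ((√(1 + k))⁻¹) ^ 2 =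
      ((√(1 + k))⁻¹) ^ 2 * (1 - (1 - k ^ 2) * ((√(1 + k))⁻¹) ^ 2) := by
    rw [hs2]
    field_simp
    ring
  rw [div_eq_iff hV0.ne', hid, Real.sqrt_mul (pow_nonneg hs0.le 2), Real.sqrt_sq hs0.le]

/-- The involution maps `(0, s_k)` ONTO `(s_k, 1)` (IVT on `[0, s_k]`). [this work] -/
theorem soloInformed_bisection_involution_image {k : ℝ} (hk : k ∈ Ioo (0:ℝ) 1) :
    (fun t : ℝ => √(1 - t ^ 2) / √(1 - (1 - k ^ 2) * t ^ 2)) '' Ioo (0:ℝ) (√(1 + k))⁻¹ =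
      Ioo (√(1 + k))⁻¹ 1 := by
  obtain ⟨hs0, hs1, hs2⟩ := soloInformed_bisectionPoint hk
  have h1k : 0 < 1 + k := by linarith [hk.1]
  refine Subset.antisymm ?_ fun y hy => ?_
  · rintro _ ⟨t, ht, rfl⟩
    exact soloInformed_bisection_involution_mem hk ht
  have hcont : ContinuousOn (fun t : ℝ => √(1 - t ^ 2) / √(1 - (1 - k ^ 2) * t ^ 2))
      (Icc 0 (√(1 + k))⁻¹) := by
    refine (continuous_const.sub (continuous_pow 2)).sqrt.continuousOn.div
      (continuous_const.sub (continuous_const.mul (continuous_pow 2))).sqrt.continuousOn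
      fun t ht => (Real.sqrt_pos.2 ?_).ne'
    have h2 : t ^ 2 ≤ ((√(1 + k))⁻¹) ^ 2 := pow_le_pow_left₀ ht.1 ht.2 2
    rw [hs2] at h2
    nlinarith [hk.2, inv_lt_one_of_one_lt₀ (show (1:ℝ) < 1 + k by linarith [hk.1]), pow_pos hk.1 2]
  have h0 : (fun t : ℝ => √(1 - t ^ 2) / √(1 - (1 - k ^ 2) * t ^ 2)) 0 = 1 := by simp
  have hs : (fun t : ℝ => √(1 - t ^ 2) / √(1 - (1 - k ^ 2) * t ^ 2)) (√(1 + k))⁻¹ =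
      (√(1 + k))⁻¹ := soloInformed_bisection_involution_fixed hk
  have hy' : y ∈ Icc ((fun t : ℝ => √(1 - t ^ 2) / √(1 - (1 - k ^ 2) * t ^ 2)) (√(1 + k))⁻¹)
      ((fun t : ℝ => √(1 - t ^ 2) / √(1 - (1 - k ^ 2) * t ^ 2)) 0) := by
    rw [h0, hs]
    exact ⟨hy.1.le, hy.2.le⟩
  obtain ⟨t, ht, hty⟩ := intermediate_value_Icc' hs0.le hcont hy'
  refine ⟨t, ⟨lt_of_le_of_ne ht.1 ?_, lt_of_le_of_ne ht.2 ?_⟩, hty⟩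
  · rintro rfl
    rw [h0] at hty
    linarith [hy.2]
  · rintro rfl
    rw [hs] at hty
    linarith [hy.1]

/-- The lifted involution is `ℚ`-semialgebraic on the slab `(0,s_k)` (`k` algebraic). [this work] -/
theorem soloInformed_bisection_involution_sa {k : ℝ} (hk : k ∈ Ioo (0:ℝ) 1)
    (hka : IsAlgebraic ℚ k) :
    IsSemialgebraicMapOn ℚ {x : Fin 1 → ℝ | x 0 ∈ Ioo (0:ℝ) (√(1 + k))⁻¹}
      (soloInformedLift fun t : ℝ => √(1 - t ^ 2) / √(1 - (1 - k ^ 2) * t ^ 2)) := by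
  obtain ⟨hs0, hs1, hs2⟩ := soloInformed_bisectionPoint hk
  have hLo : IsSemialgebraic ℚ {x : Fin 1 → ℝ | x 0 ∈ Ioo (0:ℝ) (√(1 + k))⁻¹} :=
    (isSemialgebraic_setOf_const_lt_apply isAlgebraic_zero 0).inter
      (isSemialgebraic_setOf_apply_lt_const (soloInformed_bisectionPoint_isAlgebraic hk hka) 0)
  have h1 : IsSemialgebraicFunOn ℚ {x : Fin 1 → ℝ | x 0 ∈ Ioo (0:ℝ) (√(1 + k))⁻¹}
      (fun x : Fin 1 → ℝ => 1 - x 0 ^ 2) := by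
    refine ((isSemialgebraicFunOn_const_of_isAlgebraic hLo isAlgebraic_one).sub_holds
      (isSemialgebraicFunOn_aeval hLo (MvPolynomial.X 0 ^ 2))).congr fun x _ => ?_
    simp only [Pi.sub_apply, map_pow, MvPolynomial.aeval_X]
  have h2 : IsSemialgebraicFunOn ℚ {x : Fin 1 → ℝ | x 0 ∈ Ioo (0:ℝ) (√(1 + k))⁻¹}
      (fun x : Fin 1 → ℝ => 1 - (1 - k ^ 2) * x 0 ^ 2) := by
    refine ((isSemialgebraicFunOn_const_of_isAlgebraic hLo isAlgebraic_one).sub_holds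
      ((isSemialgebraicFunOn_const_of_isAlgebraic hLo (isAlgebraic_one.sub (hka.pow 2))).mul_holds
        (isSemialgebraicFunOn_aeval hLo (MvPolynomial.X 0 ^ 2)))).congr fun x _ => ?_
    simp only [Pi.sub_apply, Pi.mul_apply, map_pow, MvPolynomial.aeval_X]
  refine IsSemialgebraicMapOn.of_forall hLo fun j => ?_
  refine ((IsSemialgebraicFunOn.sqrt_holds h1).mul_holds
    ((IsSemialgebraicFunOn.sqrt_holds h2).inv fun x hx => ?_)).congr fun x _ => ?_
  · have hx' : x 0 ∈ Ioo (0:ℝ) (√(1 + k))⁻¹ := hx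
    have hx1 : x 0 ∈ Ioo (0:ℝ) 1 := ⟨hx'.1, hx'.2.trans hs1⟩
    exact (Real.sqrt_pos.2 (soloInformed_legendre_radicand_pos' hx1 (sq_nonneg k))).ne'
  · simp only [Pi.mul_apply, soloInformedLift, div_eq_mul_inv]

/-- **The involution move**: `[(0,s_k), f] − [(s_k,1), f] ∈ relations` by ONE change of variables
`t ↦ τ(t)`. [this work] -/
theorem soloInformed_bisection_involution_move {k : ℝ} (hk : k ∈ Ioo (0:ℝ) 1)
    (hka : IsAlgebraic ℚ k) (r r' : IntegralRep 1)
    (hrd : r.domain = {x | x 0 ∈ Ioo (0:ℝ) (√(1 + k))⁻¹})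
    (hr'd : r'.domain = {x | x 0 ∈ Ioo (√(1 + k))⁻¹ 1})
    (hri : EqOn r.integrand
      (fun x => (√(1 - x 0 ^ 2))⁻¹ * (√(1 - (1 - k ^ 2) * x 0 ^ 2))⁻¹) r.domain)
    (hr'i : EqOn r'.integrand
      (fun x => (√(1 - x 0 ^ 2))⁻¹ * (√(1 - (1 - k ^ 2) * x 0 ^ 2))⁻¹) r'.domain) :
    of r - of r' ∈ relations := by
  obtain ⟨hs0, hs1, hs2⟩ := soloInformed_bisectionPoint hk
  refine changeOfVariablesRel_subset_relations (soloInformed_lift_mem_changeOfVariablesRel r r'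
    (g := fun t : ℝ => √(1 - t ^ 2) / √(1 - (1 - k ^ 2) * t ^ 2))
    (g' := fun t : ℝ => -(k ^ 2 * t) * ((√(1 - t ^ 2))⁻¹ * (√(1 - (1 - k ^ 2) * t ^ 2))⁻¹) /
      (1 - (1 - k ^ 2) * t ^ 2))
    (S := Ioo (0:ℝ) (√(1 + k))⁻¹) (T := Ioo (√(1 + k))⁻¹ 1) hrd hr'd ?_ (fun t ht => ?_) ?_ ?_
    fun x hx => ?_)
  · rw [hrd]
    exact soloInformed_bisection_involution_sa hk hka
  · exact soloInformed_bisection_involution_hasDerivAt ⟨ht.1, ht.2.trans hs1⟩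
  · exact (soloInformed_bisection_involution_injOn hk).mono (Ioo_subset_Ioo_right hs1.le)
  · exact soloInformed_bisection_involution_image hk
  · have hxS : x 0 ∈ Ioo (0:ℝ) (√(1 + k))⁻¹ := by rw [hrd] at hx; exact hx
    have hx1 : x 0 ∈ Ioo (0:ℝ) 1 := ⟨hxS.1, hxS.2.trans hs1⟩
    have hmem : soloInformedLift (fun t : ℝ => √(1 - t ^ 2) / √(1 - (1 - k ^ 2) * t ^ 2)) x ∈
        r'.domain := by
      rw [hr'd]
      exact soloInformed_bisection_involution_mem hk hxS
    rw [hri hx, hr'i hmem]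
    simp only [soloInformedLift]
    exact soloInformed_bisection_jacobian hk hx1

/-! ### LEMMA XXVIII.2 (first kind): `2⟦F̃_k⟧ = ⟦K'⟧` -/

/-- **LEMMA XXVIII.2 (first kind) — bisection of the complementary quarter-period in `P`.**
For real algebraic `0 < k < 1`, any representations `K' = [(0,1), f]` of `K(k')` and
`F = [(0,s_k), f]` of `F(φ_k,k')` (`f = ((1−t²)(1−k'²t²))^{-1/2}`, `s_k = 1/√(1+k)`) satisfy
`2·⟦F⟧ = ⟦K'⟧`: drop the null point `s_k`, split, fold the upper slab onto the lower one by the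
single involution move `t ↦ √(1−t²)/√(1−k'²t²)`. [this work] -/
theorem soloInformed_kummer_bisection_F (k : ℝ) (hk : k ∈ Ioo (0:ℝ) 1) (hka : IsAlgebraic ℚ k)
    (K' F : IntegralRep 1) (hK'd : K'.domain = {x | x 0 ∈ Ioo (0:ℝ) 1})
    (hK'i : EqOn K'.integrand
      (fun x => (√(1 - x 0 ^ 2))⁻¹ * (√(1 - (1 - k ^ 2) * x 0 ^ 2))⁻¹) K'.domain)
    (hFd : F.domain = {x | x 0 ∈ Ioo (0:ℝ) (√(1 + k))⁻¹})
    (hFi : EqOn F.integrand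
      (fun x => (√(1 - x 0 ^ 2))⁻¹ * (√(1 - (1 - k ^ 2) * x 0 ^ 2))⁻¹) F.domain) :
    2 * toFormalPeriod (of F) = toFormalPeriod (of K') := by
  obtain ⟨hs0, hs1, hs2⟩ := soloInformed_bisectionPoint hk
  have hsa := soloInformed_bisectionPoint_isAlgebraic hk hka
  have hLo : IsSemialgebraic ℚ {x : Fin 1 → ℝ | x 0 ∈ Ioo (0:ℝ) (√(1 + k))⁻¹} :=
    (isSemialgebraic_setOf_const_lt_apply isAlgebraic_zero 0).inter
      (isSemialgebraic_setOf_apply_lt_const hsa 0)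
  have hHi : IsSemialgebraic ℚ {x : Fin 1 → ℝ | x 0 ∈ Ioo (√(1 + k))⁻¹ 1} :=
    (isSemialgebraic_setOf_const_lt_apply hsa 0).inter
      (isSemialgebraic_setOf_apply_lt_const isAlgebraic_one 0)
  have hlo : {x : Fin 1 → ℝ | x 0 ∈ Ioo (0:ℝ) (√(1 + k))⁻¹} ⊆ K'.domain := fun x hx => by
    rw [hK'd]; exact ⟨hx.1, hx.2.trans hs1⟩
  have hup : {x : Fin 1 → ℝ | x 0 ∈ Ioo (√(1 + k))⁻¹ 1} ⊆ K'.domain := fun x hx => by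
    rw [hK'd]; exact ⟨hs0.trans hx.1, hx.2⟩
  have hE : {x : Fin 1 → ℝ | x 0 ∈ Ioo (0:ℝ) (√(1 + k))⁻¹} ∪
      {x : Fin 1 → ℝ | x 0 ∈ Ioo (√(1 + k))⁻¹ 1} ⊆ K'.domain := union_subset hlo hup
  -- (i) dropping the point `t = s_k` costs nothing
  have hvol : volume (K'.domain \ ({x : Fin 1 → ℝ | x 0 ∈ Ioo (0:ℝ) (√(1 + k))⁻¹} ∪
      {x : Fin 1 → ℝ | x 0 ∈ Ioo (√(1 + k))⁻¹ 1})) = 0 := by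
    refine measure_mono_null (fun x hx => ?_)
      (BallPeeling.volume_setOf_apply_eq_const 1 0 (√(1 + k))⁻¹)
    rw [hK'd] at hx
    simp only [Set.mem_sdiff, mem_setOf_eq, mem_union, mem_Ioo, not_or, not_and, not_lt] at hx
    obtain ⟨⟨h0, h1⟩, hlo', hup'⟩ := hx
    have h2 : (√(1 + k))⁻¹ ≤ x 0 := hlo' h0
    have h3 : x 0 ≤ (√(1 + k))⁻¹ := by
      by_contra h
      exact absurd (hup' (not_le.mp h)) (not_le.2 h1)
    show x 0 = (√(1 + k))⁻¹
    exact le_antisymm h3 h2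
  have h1 := IntegralRep.of_sub_of_restrict_mem_relations K' (hLo.union hHi) hE hvol
  -- (ii) the union splits (disjoint open slabs)
  have h2 : of (K'.restrict _ (hLo.union hHi) hE) - of (K'.restrict _ hLo hlo) -
      of (K'.restrict _ hHi hup) ∈ relations := by
    refine domainAddRel_subset_relations ⟨1, K'.restrict _ (hLo.union hHi) hE,
      K'.restrict _ hLo hlo, K'.restrict _ hHi hup, rfl, ?_, fun _ _ => rfl, fun _ _ => rfl, rfl⟩
    rw [IntegralRep.domain_restrict, IntegralRep.domain_restrict]
    have : {x : Fin 1 → ℝ | x 0 ∈ Ioo (0:ℝ) (√(1 + k))⁻¹} ∩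
        {x : Fin 1 → ℝ | x 0 ∈ Ioo (√(1 + k))⁻¹ 1} = ∅ := by
      ext x
      simp only [mem_inter_iff, mem_setOf_eq, mem_Ioo, mem_empty_iff_false, iff_false, not_and]
      exact fun h h' _ => by linarith [h.2, h']
    rw [this, measure_empty]
  -- (iii) the involution folds the upper slab onto the lower one
  have h3 : of (K'.restrict _ hLo hlo) - of (K'.restrict _ hHi hup) ∈ relations :=
    soloInformed_bisection_involution_move hk hka _ _ (IntegralRep.domain_restrict _ _ _ _)
      (IntegralRep.domain_restrict _ _ _ _) (fun x hx => hK'i (hlo hx)) (fun x hx => hK'i (hup hx))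
  -- (iv) `F` is the lower slab of `K'`
  have h4 : of F - of (K'.restrict _ hLo hlo) ∈ relations :=
    KZ.of_sub_of_mem_relations_of_eqOn (by rw [IntegralRep.domain_restrict, hFd]) fun x hx =>
      (hFi hx).trans (hK'i (hlo (by rw [hFd] at hx; exact hx))).symm
  have h : of K' - (of F + of F) ∈ relations := by
    have := relations.sub_mem (relations.sub_mem (relations.add_mem h1 h2) h3)
      (relations.add_mem h4 h4)
    convert this using 1
    abel
  rw [toFormalPeriod_eq_iff.mpr h, map_add, two_mul]

/-- **LEMMA XXVIII.2 (first kind), numerically: `F(φ_k, k') = K(k')/2`.** [this work] -/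
theorem soloInformed_kummer_bisection_F_value (k : ℝ) (hk : k ∈ Ioo (0:ℝ) 1)
    (hka : IsAlgebraic ℚ k) (K' F : IntegralRep 1) (hK'd : K'.domain = {x | x 0 ∈ Ioo (0:ℝ) 1})
    (hK'i : EqOn K'.integrand
      (fun x => (√(1 - x 0 ^ 2))⁻¹ * (√(1 - (1 - k ^ 2) * x 0 ^ 2))⁻¹) K'.domain)
    (hFd : F.domain = {x | x 0 ∈ Ioo (0:ℝ) (√(1 + k))⁻¹})
    (hFi : EqOn F.integrand
      (fun x => (√(1 - x 0 ^ 2))⁻¹ * (√(1 - (1 - k ^ 2) * x 0 ^ 2))⁻¹) F.domain) :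
    2 * F.value = K'.value := by
  have h := congr_arg evalP (soloInformed_kummer_bisection_F k hk hka K' F hK'd hK'i hFd hFi)
  rw [map_mul, evalP_toFormalPeriod_of, evalP_toFormalPeriod_of, map_ofNat] at h
  exact h

/-- **Existence of the incomplete representation `F̃_k = [(0,s_k), f]`** (restriction of `K'`).
[this work] -/
theorem soloInformed_exists_incompleteF_rep (k : ℝ) (hk : k ∈ Ioo (0:ℝ) 1)
    (hka : IsAlgebraic ℚ k) :
    ∃ F : IntegralRep 1, F.domain = {x | x 0 ∈ Ioo (0:ℝ) (√(1 + k))⁻¹} ∧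
      ∀ x, F.integrand x = (√(1 - x 0 ^ 2))⁻¹ * (√(1 - (1 - k ^ 2) * x 0 ^ 2))⁻¹ := by
  obtain ⟨hs0, hs1, hs2⟩ := soloInformed_bisectionPoint hk
  have hm : 1 - k ^ 2 ∈ Ioo (0:ℝ) 1 := ⟨by nlinarith [hk.1, hk.2], by nlinarith [hk.1, hk.2]⟩
  obtain ⟨K', hK'd, hK'i⟩ := soloInformed_exists_ellipticK_rep (1 - k ^ 2) hm
    (isAlgebraic_one.sub (hka.pow 2))
  have hlo : {x : Fin 1 → ℝ | x 0 ∈ Ioo (0:ℝ) (√(1 + k))⁻¹} ⊆ K'.domain := fun x hx => by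
    rw [hK'd]; exact ⟨hx.1, hx.2.trans hs1⟩
  exact ⟨K'.restrict _ ((isSemialgebraic_setOf_const_lt_apply isAlgebraic_zero 0).inter
    (isSemialgebraic_setOf_apply_lt_const (soloInformed_bisectionPoint_isAlgebraic hk hka) 0))
      hlo, rfl, fun x => by rw [IntegralRep.integrand_restrict, hK'i]⟩

end Summit.KontsevichZagierPeriods.KontsevichZagierPeriods.Theorems

end
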